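import Summits.ValiantsHypothesis.ValiantsHypothesis.Theorems.AnyonJetsJetConstantElimMultiplierBypass
import Summits.ValiantsHypothesis.ValiantsHypothesis.Theorems.AnyonJetsJetConstantElimMultiplierBypassBoolean
import Summits.ValiantsHypothesis.ValiantsHypothesis.Theorems.AnyonJetsJetConstantElimAlgebraicDescent
import Summits.ValiantsHypothesis.ValiantsHypothesis.Theorems.AnyonJetsJetConstantElimSignSimulation
import Summits.ValiantsHypothesis.ValiantsHypothesis.Theorems.AnyonJetsUniformJetUpperBound

/-!
# AnyonJets — crux `JetConstantElim` (stmt-ValiantsHypothesis-16737), line `birth`: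
# the multiplier bypass ASSEMBLED — route AnyonJets compressed to two open hypotheses,
# neither of which is `stub_multiplierRemoval`

With the bypass files (`…MultiplierBypass.lean`: `closes_ultimate`, `jetConstantElimUltimate_of`;
`…MultiplierBypassBoolean.lean`: `cfUltimate_of_perModPowBooleanHard`), the LANDED stubs
`stub_algebraicDescent` (p575059) and `stub_signSimulation` (p575638) of the line, and the PROVED
crux `UniformJetUpperBound` (`uniformJetUpperBound_proof`), the whole of route `AnyonJets` runs on
exactly two open hypotheses, both stated inline:

* `PerModPowBooleanHard` — the route's Boolean far side (support item stmt-16743, open-problem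
  grade: for every `c` some fixed `k` has no `n^c`-size `B₂`-circuits for the `k` low bits of the
  `0/1` permanent i.o.; ⊕W[1]-type hardness of per mod `2^k`, Curticapean–Xia 2015, nonuniform);
* `stub_integralMultiple'` — the registered `stub_integralMultiple` of the line (field of
  definition / height of near-optimal `ℚ̄`-circuits of the jets: an integer circuit with constants
  `≤ 2^t` for some multiple `M·J_(n,k)`, `|P| + t + 2 ≤ (|Q| + n + 2)^{b₁}`) with the one extra
  conjunct `Nat.log 2 M ≤ (|Q| + n + 2)^{b₁}`:

`valiant_of_perModPowBooleanHard_of_integralMultipleLog : PerModPowBooleanHard →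
stub_integralMultiple' → ValiantsHypothesis`, and, unconditionally in `U`, the route's TARGET
`jetExponentUnbounded_of_ultimate : CF^ult → CE^ult → JetExponentUnbounded`.

So `stub_multiplierRemoval` (the "VP⁰ with integer division" problem) and the filed crux pair
`{JetConstantElim, ConstantFreeJetGrowth}` are all off this chain: the multiplier produced by the
integral normal form is never removed — it is carried to the Boolean shadow and dissolved there.
What remains open is exactly the height/field-of-definition conjecture and the Boolean hardness.
Honest framing: a CONDITIONAL assembly; both hypotheses are open (one conjecture-grade, one a
believed-but-unproved Boolean lower bound); VP ≠ VNP is NOT proved here, and nothing in this file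
is evidence for either hypothesis.

References: P. Bürgisser, *On defining integers …*, Comput. Complexity 18 (2009); P. Koiran,
S. Perifel, *Interpolation in Valiant's theory*, Comput. Complexity 20 (2011), Rem. 4;
R. Curticapean, M. Xia, *Parameterizing the permanent*, FOCS 2015; L. G. Valiant, *The complexity
of computing the permanent*, TCS 8 (1979), §4.
-/

noncomputable section

-- single-conjunct layout: Sub = Summit, duplicated namespace component intended
set_option linter.dupNamespace false

namespace Summit.ValiantsHypothesis.ValiantsHypothesis.Theorems.AnyonJets.JetConstantElim

open MvPolynomial Literature.Computability.AlgebraicComplexity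
open Summit.ValiantsHypothesis.ValiantsHypothesis.Theses.AnyonJets
open Summit.ValiantsHypothesis.ValiantsHypothesis.Theorems.AnyonJets.ConstantFreeJetGrowth (jet)

/-- **Route AnyonJets on two hypotheses, without multiplier removal**:
`PerModPowBooleanHard → stub_integralMultiple' → VP_ℂ ≠ VNP_ℂ`, by
`closes_ultimate (cfUltimate_of_perModPowBooleanHard _) (jetConstantElimUltimate_of
stub_algebraicDescent _ stub_signSimulation) uniformJetUpperBound_proof`. CONDITIONAL: both
hypotheses are open. [folklore] -/
theorem valiant_of_perModPowBooleanHard_of_integralMultipleLog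
    (hHard : PerModPowBooleanHard)
    (hI : let J := fun (n k : ℕ) => (∑ σ : Equiv.Perm (Fin n), MvPolynomial.C (((Equiv.Perm.sign σ : ℤˣ) : ℤ) * (((Finset.univ.filter (fun p : Fin n × Fin n => p.1 < p.2 ∧ σ p.2 < σ p.1)).card.choose k : ℕ) : ℤ)) * ∏ i : Fin n, MvPolynomial.X (σ i, i) : MvPolynomial (Fin n × Fin n) ℤ);
      ∃ b₁ : ℕ, ∀ n k : ℕ, k ≤ Nat.log 2 n →
        ∀ Q : Literature.Computability.AlgebraicComplexity.ArithCircuit (AlgebraicClosure ℚ) (Fin n × Fin n),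
          Q.IsFanInTwo →
          Q.Computes (MvPolynomial.map (Int.castRingHom (AlgebraicClosure ℚ)) (J n k)) →
          ∃ (P : Literature.Computability.AlgebraicComplexity.ArithCircuit ℤ (Fin n × Fin n)) (t M : ℕ),
            1 ≤ M ∧ P.IsFanInTwo ∧ P.Computes ((M : ℤ) • J n k) ∧
            ((∀ g ∈ P.gates, ∀ u ∈ g.args, ∀ c : ℤ, u = .const c → c.natAbs ≤ 2 ^ t) ∧
              (∀ args : List (ℤ × Literature.Computability.AlgebraicComplexity.ArithCircuit.Operand ℤ (Fin n × Fin n)),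
                Literature.Computability.AlgebraicComplexity.ArithCircuit.Gate.sum args ∈ P.gates →
                  ∀ a ∈ args, a.1.natAbs ≤ 2 ^ t) ∧
              (∀ c : ℤ, P.output = .const c → c.natAbs ≤ 2 ^ t)) ∧
            P.size + t + 2 ≤ (Q.size + n + 2) ^ b₁ ∧ Nat.log 2 M ≤ (Q.size + n + 2) ^ b₁) :
    _root_.ValiantsHypothesis :=
  closes_ultimate (cfUltimate_of_perModPowBooleanHard hHard)
    (jetConstantElimUltimate_of stub_algebraicDescent hI stub_signSimulation) uniformJetUpperBound_proof

/-- `JetExponentUnbounded` with the route's `let J` replaced by the tree's `jet` (rfl). [folklore] -/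
theorem jetExponentUnbounded_iff_jet :
    JetExponentUnbounded ↔ ∀ c : ℕ, ∃ k : ℕ, ∀ n₀ : ℕ, ∃ n : ℕ, n₀ ≤ n ∧
      n ^ c < complexity (MvPolynomial.map (Int.castRingHom ℂ) (jet n k)) :=
  Iff.rfl

/-- **The route's TARGET from the two ultimate cruxes**: `CF^ult → CE^ult → JetExponentUnbounded`
(mirror of the strategist's `CE → CF → X`): given `c`, `CE^ult` gives `b`; `CF^ult` at
`c' = (c+2)b + 1` gives `k` and arbitrarily large `n` at which every admissible multiple of `J_(n,k)`
costs `≥ n^{c'}`; if `L_ℂ(J_(n,k)) ≤ n^c` there, the multiple `M·J_(n,k)` from `CE^ult`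
(`v₂(M) ≤ log₂ M ≤ (L+n+2)^b ≤ n^{c'}`) costs `≤ n^{(c+2)b} < n^{c'}` — absurd; so `L_ℂ(J_(n,k)) > n^c`.
[folklore] -/
theorem jetExponentUnbounded_of_ultimate
    (hCF : ∀ c : ℕ, ∃ k : ℕ, 1 ≤ k ∧ ∀ n₀ : ℕ, ∃ n : ℕ, n₀ ≤ n ∧ ∀ M : ℕ, 1 ≤ M →
      padicValNat 2 M ≤ n ^ c → n ^ c ≤ constantFreeComplexity ((M : ℤ) • jet n k))
    (hCE : ∃ b : ℕ, ∀ n k : ℕ, k ≤ Nat.log 2 n → ∃ M : ℕ, 1 ≤ M ∧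
      Nat.log 2 M ≤ (complexity (MvPolynomial.map (Int.castRingHom ℂ) (jet n k)) + n + 2) ^ b ∧
      constantFreeComplexity ((M : ℤ) • jet n k) ≤
        (complexity (MvPolynomial.map (Int.castRingHom ℂ) (jet n k)) + n + 2) ^ b) :
    JetExponentUnbounded := by
  refine jetExponentUnbounded_iff_jet.mpr fun c => ?_
  obtain ⟨b, hb⟩ := hCE
  obtain ⟨k, -, hk⟩ := hCF ((c + 2) * b + 1)
  refine ⟨k, fun n₀ => ?_⟩
  obtain ⟨n, hn, hτ⟩ := hk (max n₀ (max (2 ^ k) 3))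
  have hn₀ : n₀ ≤ n := le_trans (le_max_left _ _) hn
  have h2k : 2 ^ k ≤ n := le_trans (le_trans (le_max_left _ _) (le_max_right _ _)) hn
  have h3 : 3 ≤ n := le_trans (le_trans (le_max_right _ _) (le_max_right _ _)) hn
  have hklog : k ≤ Nat.log 2 n := Nat.le_log_of_pow_le (by norm_num) h2k
  refine ⟨n, hn₀, ?_⟩
  obtain ⟨M, hM, hlogM, hτM⟩ := hb n k hklog
  set L := complexity (MvPolynomial.map (Int.castRingHom ℂ) (jet n k)) with hL
  by_contra hle
  push Not at hle
  -- `L + n + 2 ≤ n^(c+2)`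
  have hn1 : 1 ≤ n := by omega
  have hpow1 : n ≤ n ^ (c + 1) := by
    calc n = n ^ 1 := (pow_one n).symm
      _ ≤ n ^ (c + 1) := Nat.pow_le_pow_right hn1 (by omega)
  have hpow2 : n ^ c ≤ n ^ (c + 1) := Nat.pow_le_pow_right hn1 (by omega)
  have hsum : L + n + 2 ≤ n ^ (c + 2) := by
    have : L + n + 2 ≤ 3 * n ^ (c + 1) := by omega
    calc L + n + 2 ≤ 3 * n ^ (c + 1) := this
      _ ≤ n * n ^ (c + 1) := Nat.mul_le_mul_right _ h3
      _ = n ^ (c + 2) := by ring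
  have hXb : (L + n + 2) ^ b ≤ n ^ ((c + 2) * b) := by
    calc (L + n + 2) ^ b ≤ (n ^ (c + 2)) ^ b := Nat.pow_le_pow_left hsum b
      _ = n ^ ((c + 2) * b) := by rw [← pow_mul]
  have hlt : n ^ ((c + 2) * b) < n ^ ((c + 2) * b + 1) := Nat.pow_lt_pow_right (by omega) (by omega)
  have hv : padicValNat 2 M ≤ n ^ ((c + 2) * b + 1) := by
    have h1 : padicValNat 2 M ≤ Nat.log 2 M := padicValNat_le_nat_log M
    omega
  have hchain : n ^ ((c + 2) * b + 1) ≤ n ^ ((c + 2) * b) :=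
    calc n ^ ((c + 2) * b + 1) ≤ constantFreeComplexity ((M : ℤ) • jet n k) := hτ M hM hv
      _ ≤ (L + n + 2) ^ b := hτM
      _ ≤ n ^ ((c + 2) * b) := hXb
  omega

/-- **The route's target on the two open hypotheses**:
`PerModPowBooleanHard → stub_integralMultiple' → JetExponentUnbounded` (the target item
stmt-16736, reached without `stub_multiplierRemoval`, `JetConstantElim` or `ConstantFreeJetGrowth`).
CONDITIONAL. [folklore] -/
theorem jetExponentUnbounded_of_perModPowBooleanHard_of_integralMultipleLog
    (hHard : PerModPowBooleanHard)
    (hI : let J := fun (n k : ℕ) => (∑ σ : Equiv.Perm (Fin n), MvPolynomial.C (((Equiv.Perm.sign σ : ℤˣ) : ℤ) * (((Finset.univ.filter (fun p : Fin n × Fin n => p.1 < p.2 ∧ σ p.2 < σ p.1)).card.choose k : ℕ) : ℤ)) * ∏ i : Fin n, MvPolynomial.X (σ i, i) : MvPolynomial (Fin n × Fin n) ℤ);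
      ∃ b₁ : ℕ, ∀ n k : ℕ, k ≤ Nat.log 2 n →
        ∀ Q : Literature.Computability.AlgebraicComplexity.ArithCircuit (AlgebraicClosure ℚ) (Fin n × Fin n),
          Q.IsFanInTwo →
          Q.Computes (MvPolynomial.map (Int.castRingHom (AlgebraicClosure ℚ)) (J n k)) →
          ∃ (P : Literature.Computability.AlgebraicComplexity.ArithCircuit ℤ (Fin n × Fin n)) (t M : ℕ),
            1 ≤ M ∧ P.IsFanInTwo ∧ P.Computes ((M : ℤ) • J n k) ∧
            ((∀ g ∈ P.gates, ∀ u ∈ g.args, ∀ c : ℤ, u = .const c → c.natAbs ≤ 2 ^ t) ∧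
              (∀ args : List (ℤ × Literature.Computability.AlgebraicComplexity.ArithCircuit.Operand ℤ (Fin n × Fin n)),
                Literature.Computability.AlgebraicComplexity.ArithCircuit.Gate.sum args ∈ P.gates →
                  ∀ a ∈ args, a.1.natAbs ≤ 2 ^ t) ∧
              (∀ c : ℤ, P.output = .const c → c.natAbs ≤ 2 ^ t)) ∧
            P.size + t + 2 ≤ (Q.size + n + 2) ^ b₁ ∧ Nat.log 2 M ≤ (Q.size + n + 2) ^ b₁) :
    JetExponentUnbounded :=
  jetExponentUnbounded_of_ultimate (cfUltimate_of_perModPowBooleanHard hHard)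
    (jetConstantElimUltimate_of stub_algebraicDescent hI stub_signSimulation)

end Summit.ValiantsHypothesis.ValiantsHypothesis.Theorems.AnyonJets.JetConstantElim

end
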